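import Mathlib
import HarnessLib

/-!
# Hoeffding's lemma in entropy form: a bounded function satisfies Herbst's entropy inequality

Pure measure-theoretic probability; everything in this file is proved (no definitions, no named facts).
Companion (converse direction) of `Literature/Probability/Moments/HerbstArgument.lean`.

Let `ν` be a probability measure and `ψ` a real function with `a ≤ ψ ≤ b` almost surely.  Writing
`Λ(t) = log ∫ e^{tψ} dν` (the cumulant generating function, Mathlib `ProbabilityTheory.cgf`), the tilted
measures `e^{tψ}ν/∫e^{tψ}` are again supported in `[a, b]`, so `Λ''(t) = Var_{tilted}(ψ) ≤ ((b − a)/2)²`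
(Giné–Nickl Lemma 3.1.1, display (3.6); Mathlib `variance_tilted_mul`, `variance_le_sq_of_bounded`).  The ENTROPY of
`e^{tψ}` is `Ent_ν(e^{tψ}) = ∫ e^{tψ}·tψ dν − (∫ e^{tψ} dν)·log ∫ e^{tψ} dν = (∫ e^{tψ} dν)·(tΛ'(t) − Λ(t))`
(Giné–Nickl (3.118)) and `tΛ'(t) − Λ(t) = ∫₀ᵗ sΛ''(s) ds ≤ t²(b − a)²/8`, whence **Hoeffding's lemma in
entropy form** (Giné–Nickl (3.119), the input of the entropy method for bounded differences, Thm 3.3.14):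

  `Ent_ν(e^{tψ}) ≤ (t²(b − a)²/8) · ∫ e^{tψ} dν`   for every real `t`

(`entropy_exp_mul_le_of_mem_Icc`).  We also record the un-normalised form on a measurable window `W` of a
finite measure `μ` (`setIntegral_entropy_exp_mul_le_of_mem_Icc`):
`∫_W e^{tf}·tf dμ − (∫_W e^{tf} dμ)·log((∫_W e^{tf} dμ)/μ(W)) ≤ (t²(b − a)²/8)·∫_W e^{tf} dμ` whenever
`a ≤ f ≤ b` on `W` — the shape in which Herbst-type hypotheses are stated for restricted Gibbs measures.

The proof runs the calculus of `HerbstArgument.cgf_le_of_entropy_le_of_pos` backwards: instead of integrating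
the entropy inequality to bound `Λ`, one differentiates `φ(s) = sΛ'(s) − Λ(s) − ((b−a)/2)²s²/2`,
`φ'(s) = s(Λ''(s) − ((b−a)/2)²)`, which is `≤ 0` for `s ≥ 0` and `≥ 0` for `s ≤ 0`, so `φ ≤ φ(0) = 0`.

What is NOT here: logarithmic Sobolev inequalities, tensorisation, the bounded-differences inequality itself
(Mathlib has Hoeffding's lemma for the MGF, `ProbabilityTheory.hasSubgaussianMGF_of_mem_Icc`, which is the
integrated statement `Λ(t) − tΛ'(0) ≤ t²(b−a)²/8`; the entropy form is the statement about `tΛ'(t) − Λ(t)`).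

## References

* E. Giné, R. Nickl, *Mathematical Foundations of Infinite-Dimensional Statistical Models*, Cambridge
  University Press (2016/2021), Lemma 3.1.1 (3.6) and the proof of Theorem 3.3.14, (3.118)–(3.119). [GineNickl2021]
* S. Boucheron, G. Lugosi, P. Massart, *Concentration Inequalities*, OUP (2013), Lemma 2.2 and §6.1. [BoucheronLugosiMassart2013]
-/

namespace Literature.Probability.Moments

open _root_.MeasureTheory _root_.ProbabilityTheory _root_.Real _root_.Filter _root_.Set
open scoped _root_.Topology _root_.NNReal _root_.ENNReal

variable {α : Type*} [MeasurableSpace α]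

section Probability

variable (ν : Measure α) [IsProbabilityMeasure ν] {ψ : α → ℝ} {a b : ℝ}

/-- **Giné–Nickl (3.6) at every parameter.** If `a ≤ ψ ≤ b` almost surely under the probability measure `ν`,
then the second derivative of the cumulant generating function `Λ = log ∫ e^{tψ} dν` satisfies
`Λ''(t) ≤ ((b − a)/2)²` for every real `t` (it is the variance of `ψ` under the tilted probability
measure, which is still supported in `[a, b]`). [cite: GineNickl2021, Lemma 3.1.1 (3.6)] -/
theorem iteratedDeriv_two_cgf_le_of_mem_Icc (hψ : AEMeasurable ψ ν) (hb : ∀ᵐ y ∂ν, ψ y ∈ Icc a b)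
    (t : ℝ) : iteratedDeriv 2 (cgf ψ ν) t ≤ ((b - a) / 2) ^ 2 := by
  have hint : ∀ s : ℝ, Integrable (fun y => exp (s * ψ y)) ν := fun s =>
    integrable_exp_mul_of_mem_Icc hψ hb
  have hmem : t ∈ interior (integrableExpSet ψ ν) := by
    rw [(eq_univ_of_forall hint : integrableExpSet ψ ν = univ), interior_univ]
    exact mem_univ t
  rw [← variance_tilted_mul hmem]
  haveI : IsProbabilityMeasure (ν.tilted fun y => t * ψ y) := isProbabilityMeasure_tilted (hint t)
  exact variance_le_sq_of_bounded ((tilted_absolutelyContinuous ν _) hb)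
    (hψ.mono_ac (tilted_absolutelyContinuous ν _))

/-- **Hoeffding's lemma in entropy form (probability measure).** If `a ≤ ψ ≤ b` almost surely under the
probability measure `ν`, then for every real `t`
`Ent_ν(e^{tψ}) = ∫ e^{tψ}·(tψ) dν − (∫ e^{tψ} dν)·log(∫ e^{tψ} dν) ≤ (t²(b − a)²/8)·∫ e^{tψ} dν`.
[cite: GineNickl2021, Thm 3.3.14 proof (3.118)-(3.119)] -/
theorem entropy_exp_mul_le_of_mem_Icc (hψ : AEMeasurable ψ ν) (hb : ∀ᵐ y ∂ν, ψ y ∈ Icc a b) (t : ℝ) :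
    ∫ y, exp (t * ψ y) * (t * ψ y) ∂ν - (∫ y, exp (t * ψ y) ∂ν) * log (∫ y, exp (t * ψ y) ∂ν) ≤
      (b - a) ^ 2 / 8 * t ^ 2 * ∫ y, exp (t * ψ y) ∂ν := by
  have hint : ∀ s : ℝ, Integrable (fun y => exp (s * ψ y)) ν := fun s =>
    integrable_exp_mul_of_mem_Icc hψ hb
  have hmem : ∀ s : ℝ, s ∈ interior (integrableExpSet ψ ν) := fun s => by
    rw [(eq_univ_of_forall hint : integrableExpSet ψ ν = univ), interior_univ]
    exact mem_univ s
  have hZ : ∀ s, 0 < mgf ψ ν s := fun s => mgf_pos (hint s)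
  -- `Λ = cgf ψ ν` is differentiable, and so is `Λ'`, with `(Λ')' = iteratedDeriv 2 Λ`
  set Λ : ℝ → ℝ := cgf ψ ν with hΛ
  have hΛd : ∀ s, HasDerivAt Λ (deriv Λ s) s := fun s =>
    ((hasDerivAt_mgf (hmem s)).log (hZ s).ne').differentiableAt.hasDerivAt
  have hΛ'd : ∀ s, HasDerivAt (deriv Λ) (iteratedDeriv 2 Λ s) s := fun s => by
    have h2 : iteratedDeriv 2 Λ = deriv (deriv Λ) := by
      rw [show (2 : ℕ) = 1 + 1 from rfl, iteratedDeriv_succ, iteratedDeriv_one]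
    rw [h2]
    exact (analyticAt_cgf (hmem s)).deriv.differentiableAt.hasDerivAt
  -- the comparison function `φ(s) = sΛ'(s) − Λ(s) + Λ(0) − c s²/2`, `c = ((b−a)/2)²`
  set c : ℝ := ((b - a) / 2) ^ 2 with hc
  set φ : ℝ → ℝ := fun s => s * deriv Λ s - Λ s + Λ 0 - c / 2 * s ^ 2 with hφ
  have hφd : ∀ s, HasDerivAt φ (s * (iteratedDeriv 2 Λ s - c)) s := fun s => by
    have h1 : HasDerivAt (fun x => x * deriv Λ x) (1 * deriv Λ s + s * iteratedDeriv 2 Λ s) s :=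
      (hasDerivAt_id' s).mul (hΛ'd s)
    have h3 : HasDerivAt (fun x : ℝ => c / 2 * x ^ 2) (c / 2 * (2 * s)) s := by
      simpa using (hasDerivAt_pow 2 s).const_mul (c / 2)
    have h : HasDerivAt φ (1 * deriv Λ s + s * iteratedDeriv 2 Λ s - deriv Λ s - c / 2 * (2 * s)) s :=
      ((h1.sub (hΛd s)).add_const (Λ 0)).sub h3
    exact h.congr_deriv (by ring)
  have hkey : ∀ s, iteratedDeriv 2 Λ s - c ≤ 0 := fun s =>
    sub_nonpos.2 (iteratedDeriv_two_cgf_le_of_mem_Icc ν hψ hb s)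
  have hφ0 : φ 0 = 0 := by simp [hφ]
  have hφle : φ t ≤ 0 := by
    rcases le_or_gt 0 t with ht | ht
    · have hanti : AntitoneOn φ (Ici 0) :=
        antitoneOn_of_deriv_nonpos (convex_Ici 0)
          (fun s _ => (hφd s).continuousAt.continuousWithinAt)
          (fun s _ => (hφd s).differentiableAt.differentiableWithinAt)
          fun s hs => by
            rw [interior_Ici] at hs
            rw [(hφd s).deriv]
            exact mul_nonpos_iff.2 (Or.inl ⟨le_of_lt hs, hkey s⟩)
      have h := hanti (self_mem_Ici (a := (0 : ℝ))) (mem_Ici.2 ht) ht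
      rwa [hφ0] at h
    · have hmono : MonotoneOn φ (Iic 0) :=
        monotoneOn_of_deriv_nonneg (convex_Iic 0)
          (fun s _ => (hφd s).continuousAt.continuousWithinAt)
          (fun s _ => (hφd s).differentiableAt.differentiableWithinAt)
          fun s hs => by
            rw [interior_Iic] at hs
            rw [(hφd s).deriv]
            exact mul_nonneg_iff.2 (Or.inr ⟨le_of_lt hs, hkey s⟩)
      have h := hmono (mem_Iic.2 ht.le) (self_mem_Iic (a := (0 : ℝ))) ht.le
      rwa [hφ0] at h
  -- rewrite the entropy in terms of `Λ` and `Λ'`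
  have h2 : ∫ y, exp (t * ψ y) * (t * ψ y) ∂ν = t * ∫ y, ψ y * exp (t * ψ y) ∂ν := by
    rw [← integral_const_mul]
    exact integral_congr_ae (ae_of_all _ fun y => by ring)
  have hI : ∫ y, ψ y * exp (t * ψ y) ∂ν = deriv Λ t * mgf ψ ν t := by
    rw [hΛ, deriv_cgf (hmem t), div_mul_cancel₀ _ (hZ t).ne']
  have hmgf : ∫ y, exp (t * ψ y) ∂ν = mgf ψ ν t := rfl
  rw [h2, hI, hmgf]
  change t * (deriv Λ t * mgf ψ ν t) - mgf ψ ν t * Λ t ≤ (b - a) ^ 2 / 8 * t ^ 2 * mgf ψ ν t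
  have hΛ0 : Λ 0 = 0 := cgf_zero
  have hφt : t * deriv Λ t - Λ t ≤ c / 2 * t ^ 2 := by
    have h := hφle
    simp only [hφ, hΛ0, add_zero] at h
    linarith
  have hc8 : c / 2 * t ^ 2 = (b - a) ^ 2 / 8 * t ^ 2 := by rw [hc]; ring
  rw [hc8] at hφt
  nlinarith [mul_le_mul_of_nonneg_left hφt (hZ t).le]

end Probability

section Window

variable (μ : Measure α) [IsFiniteMeasure μ] {f : α → ℝ} {a b : ℝ} {W : Set α}

/-- **Hoeffding's lemma in entropy form on a window of a finite measure.** If `W` is measurable and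
`a ≤ f ≤ b` on `W`, then for every real `t`
`∫_W e^{tf}·(tf) dμ − (∫_W e^{tf} dμ)·log((∫_W e^{tf} dμ)/μ(W)) ≤ (t²(b − a)²/8)·∫_W e^{tf} dμ`
(the probability-measure statement for the normalised restriction `μ(· | W)`, multiplied back by `μ(W)`; both
sides vanish when `μ(W) = 0`). [cite: GineNickl2021, Thm 3.3.14 proof (3.118)-(3.119)] -/
theorem setIntegral_entropy_exp_mul_le_of_mem_Icc (hW : MeasurableSet W) (hf : Measurable f)
    (hb : ∀ x ∈ W, f x ∈ Icc a b) (t : ℝ) :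
    ∫ x in W, exp (t * f x) * (t * f x) ∂μ -
        (∫ x in W, exp (t * f x) ∂μ) * log ((∫ x in W, exp (t * f x) ∂μ) / μ.real W) ≤
      (b - a) ^ 2 / 8 * t ^ 2 * ∫ x in W, exp (t * f x) ∂μ := by
  by_cases hW0 : μ W = 0
  · have h0 : μ.restrict W = 0 := Measure.restrict_eq_zero.2 hW0
    simp [h0]
  -- normalise the window: `ν = μ[|W] = (μ W)⁻¹ • μ.restrict W` is a probability measure
  have hWtop : μ W ≠ ∞ := measure_ne_top μ W
  haveI : IsProbabilityMeasure (μ[|W]) := cond_isProbabilityMeasure hW0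
  have hbν : ∀ᵐ x ∂(μ[|W]), f x ∈ Icc a b := by
    rw [ProbabilityTheory.cond]
    exact Measure.ae_smul_measure (ae_restrict_of_forall_mem hW hb) _
  have hP := entropy_exp_mul_le_of_mem_Icc (μ[|W]) hf.aemeasurable hbν t
  -- integrals against `ν` are `(μ W)⁻¹ ·` the window integrals
  have hsc : ∀ g : α → ℝ, ∫ x, g x ∂(μ[|W]) = (μ.real W)⁻¹ * ∫ x in W, g x ∂μ := fun g => by
    rw [ProbabilityTheory.cond, integral_smul_measure, ENNReal.toReal_inv, smul_eq_mul, measureReal_def]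
  have hm : 0 < μ.real W := by
    rw [measureReal_def]
    exact ENNReal.toReal_pos hW0 hWtop
  rw [hsc, hsc] at hP
  set I₀ : ℝ := ∫ x in W, exp (t * f x) ∂μ with hI₀
  set I₁ : ℝ := ∫ x in W, exp (t * f x) * (t * f x) ∂μ with hI₁
  set m : ℝ := μ.real W with hmdef
  -- `hP : m⁻¹ I₁ − (m⁻¹ I₀)·log(m⁻¹ I₀) ≤ (b−a)²/8·t²·(m⁻¹ I₀)`; multiply by `m > 0`
  have hdiv : m⁻¹ * I₀ = I₀ / m := by rw [inv_mul_eq_div]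
  rw [hdiv] at hP
  have hmul := mul_le_mul_of_nonneg_left hP hm.le
  have e1 : m * (m⁻¹ * I₁ - I₀ / m * log (I₀ / m)) = I₁ - I₀ * log (I₀ / m) := by
    field_simp
  have e2 : m * ((b - a) ^ 2 / 8 * t ^ 2 * (I₀ / m)) = (b - a) ^ 2 / 8 * t ^ 2 * I₀ := by
    field_simp
  rw [e1, e2] at hmul
  exact hmul

end Window

end Literature.Probability.Moments
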